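import Literature.Barriers.ValiantsHypothesis.BDGIL24IsotypicProjectorsExist
import Literature.Barriers.ValiantsHypothesis.BDGIL24EnvelopingAlgebraAction
import Literature.Barriers.ValiantsHypothesis.BDGIL24GelfandTsetlinUniqueness
import HarnessLib

/-!
# Gelfand–Tsetlin (`GZ`-isotypic) projectors as elements of `U(gl_k)` ([BDGIL24, §5.1.4, Cor. 5.8],
# existence clause) — PROVED (`BergEtAl2024.cor_5_8_exists`)

[BDGIL24] = M. van den Berg, P. Dutta, F. Gesmundo, C. Ikenmeyer, V. Lysikov, *Algebraic
metacomplexity and representation theory*, arXiv:2411.03444, §5.1.4 (p.28, PDF p.29; held text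
paper:arxiv-2411.03444 p0029.txt:L4–L26):

> "Let `V` be a representation of a complex reductive Lie group `G` with the corresponding Lie
> algebra `𝔤` admitting a Gelfand–Tsetlin chain `𝔤₁ ⊂ 𝔤₂ ⊂ ⋯ ⊂ 𝔤_k = 𝔤`. As discussed in Section 4.5,
> under the action of the Gelfand–Tsetlin algebra `GZ(𝔤)` the representation `V` decomposes into
> `GZ`-isotypic components indexed by Gelfand–Tsetlin patterns, and Theorem 5.2 can be used to
> construct for every Gelfand–Tsetlin pattern `T` an element `Y_T ∈ U(𝔤)` such that `Y_T.x` is the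
> projection of `x` onto the `T`-isotypic subspace of `V`. […] **Corollary 5.8.** For each
> semistandard tableau `T` of shape `λ ⊢_k δd` there is an element `Y_T ∈ U(gl_k)` of length at
> most `k(δd)^{k²}` which acts on `ℂ[ℂ[x₁,…,x_k]_d]_δ` as the projector onto the `T`-isotypic space
> corresponding to `T`."

## What is typed and proved

**`cor_5_8_exists`** — the EXISTENCE clause of Cor. 5.8 in the tree's vocabulary: for every format
`(δ, d, k)` and every chain of integral weights `T : GTPattern k` (the tree's index type for
Gelfand–Tsetlin patterns, `BDGIL24GelfandTsetlinComponents.lean`; non-occurring chains have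
component `0`) there is an element `Y` of the subalgebra of `End` generated by the `lieOp N` (the
image of `U(gl_k)`, Claim 4.2) acting on every homogeneous metapolynomial `Δ` of degree `δ` as THE
projector onto the `T`-isotypic space `V_T = gtSubspace (coordRep (Fin k) ℂ d) T`: `Y Δ ∈ V_T` and
`Δ − Y Δ ∈ ⨆_{T'≠T} V_{T'}` (the characterisation by which the tree renders "the projection onto
the `T`-isotypic space", `thm_1_1_gt`; unique by `gtComponent_unique`).

Route (disclosed deviation, as for `cor_5_6_exists`): the tree's `V_T` is the joint isotypic space
`⋂_j (T j)`-isotypic component of the restriction of `coordRep` to `GL_j ↪ GL_k` (`gtSubspace`), so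
`Y = Z_0 Z_1 ⋯ Z_k` is taken to be the ordered product over the levels of the chain of level-`j`
isotypic projectors `Z_j`, each an element of the `lieOp`-algebra by the double-commutant argument
at level `j` (`exists_adjoin_lieOp_isotypicProjector_glLift`: Jacobson density for the
finite-dimensional rational `GL_j`-representation on `ℂ[ℂ[x]_d]_δ`, plus
`exists_adjoin_lieOp_eq_coordRep`); on a homogeneous vector of `V_{T'}` such a product is the
identity if `T' = T` and `0` otherwise (`list_prod_apply_eq_ite`), and `ℂ[ℂ[x]_d]_δ` is the sum of
its intersections with the `V_{T'}` (`le_iSup_inf_gtSubspace`). The printed construction applies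
Thm. 5.2 to the Casimir elements of the `gl_ℓ`; the printed LENGTH bound `k(δd)^{k²}` rests on their
central characters and is NOT typed.

`cor_5_8_exists_envAct` restates the result with `Y ∈ U(gl_k)` literally (`BDGIL24EnvelopingAlgebraAction.envAct`).

Honest framing: representation-theoretic bookkeeping; nothing here bears on `VP ≠ VNP`.

## References
* [BergEtAl2024] arXiv:2411.03444, §5.1.4 and Cor. 5.8 (p.28, PDF p.29); §4.5 (p.22–23).
* [GoodmanWallachGTM255] §4.1.6 (isotypic decomposition); Jacobson density (Mathlib
  `jacobson_density`).
-/

noncomputable section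

open MvPolynomial
open scoped BigOperators

namespace Literature.Barriers.ValiantsHypothesis

namespace BergEtAl2024

open Literature.Computability.AlgebraicComplexity Literature.NumberTheory.DiophantineGeometry

/-! ### Projector calculus on isotypic components -/

section Projector

variable {σ K W : Type*} [Fintype σ] [LinearOrder σ] [Field K] [AddCommGroup W] [Module K W]

/-- If `Z v` is the `χ`-isotypic component of `v` (i.e. `Z v ∈ W_χ` and `v − Z v ∈ ⨆_{χ'≠χ} W_{χ'}`)
and `v` already lies in the `χ`-isotypic component `W_χ = hwSubrep ρ χ`, then `Z v = v`
(independence of the isotypic components). [cite: GoodmanWallachGTM255, §4.1.6 (isotypic decomposition)] -/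
theorem apply_eq_self_of_mem_hwSubrep {ρ : Representation K (GL σ K) W}
    (hind : iSupIndep fun χ => hwSubrep ρ χ) {χ : Weight σ} {Z : Module.End K W} {v : W}
    (hZv : Z v ∈ hwSubrep ρ χ)
    (hvZ : v - Z v ∈ ⨆ χ' ∈ {χ' : Weight σ | χ' ≠ χ}, hwSubrep ρ χ') (hv : v ∈ hwSubrep ρ χ) :
    Z v = v :=
  eq_of_iSupIndep_hwSubrep hind hZv hvZ hv (by rw [sub_self]; exact Submodule.zero_mem _)

/-- If `Z v` is the `χ`-isotypic component of `v` and `v` lies in ANOTHER isotypic component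
`W_{χ'}`, `χ' ≠ χ`, then `Z v = 0`. [cite: GoodmanWallachGTM255, §4.1.6 (isotypic decomposition)] -/
theorem apply_eq_zero_of_mem_hwSubrep_of_ne {ρ : Representation K (GL σ K) W}
    (hind : iSupIndep fun χ => hwSubrep ρ χ) {χ χ' : Weight σ} (hne : χ' ≠ χ) {Z : Module.End K W}
    {v : W} (hZv : Z v ∈ hwSubrep ρ χ)
    (hvZ : v - Z v ∈ ⨆ χ'' ∈ {χ'' : Weight σ | χ'' ≠ χ}, hwSubrep ρ χ'') (hv : v ∈ hwSubrep ρ χ') :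
    Z v = 0 :=
  eq_of_iSupIndep_hwSubrep hind hZv hvZ (Submodule.zero_mem _)
    (by rw [sub_zero]; exact Submodule.mem_iSup_of_mem χ' (Submodule.mem_iSup_of_mem hne hv))

end Projector

/-! ### Level-wise isotypic projectors inside the `lieOp`-algebra -/

section GZ

variable {k d : ℕ}

/-- The isotypic components of the restriction of `coordRep` to `GL_ℓ ↪ GL_k`, `g ↦ diag(g, 1)`, are
independent (the restriction is rational and locally finite).
[cite: BergEtAl2024, §4.5, p.22 (PDF p.23)] locator: paper:arxiv-2411.03444 p0023.txt:L8–L12 -/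
theorem iSupIndep_hwSubrep_coordRep_comp_glLift {ℓ : ℕ} (h : ℓ ≤ k) :
    iSupIndep fun χ => hwSubrep ((coordRep (Fin k) ℂ d).comp (glLift h)) χ :=
  iSupIndep_hwSubrep_of_locallyFinite (isRationalRep_comp_glLift (isRationalRep_coordRep d) h)
    (locallyFinite_comp exists_subrepresentation_coordRep_mem (glLift h))

/-- **Cor. 5.6 along the Gelfand–Tsetlin chain** `gl_1 ⊂ gl_2 ⊂ ⋯ ⊂ gl_k`: for every level `ℓ ≤ k`,
degree `δ` and weight `χ` of `GL_ℓ` there is an element `Z` of the `lieOp`-algebra (indeed of the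
image of `ℂ[GL_ℓ] ⊆ ℂ[GL_k]` restricted to degree `δ`, hence of the image of `U(gl_ℓ) ⊆ U(gl_k)`)
acting on the homogeneous metapolynomials of degree `δ` as THE projector onto the `χ`-isotypic
component of the RESTRICTION of `coordRep` to `GL_ℓ ↪ GL_k`: `Z Δ ∈ hwSubrep (coordRep ∘ diag(·,1)) χ`
and `Δ − Z Δ ∈ ⨆_{χ'≠χ} hwSubrep (coordRep ∘ diag(·,1)) χ'`. Same double-commutant route as
`cor_5_6_exists` (which is the level `ℓ = k`); the printed route uses the Casimir elements of
`gl_ℓ` ("For the chain `gl_1 ⊂ gl_2 ⊂ ⋯ ⊂ gl_k`, Casimir elements have length at most `k`"), whose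
length bound is NOT typed.
[cite: BergEtAl2024, §5.1.4, p.28 (PDF p.29)] locator: paper:arxiv-2411.03444 p0029.txt:L4–L15
[cite: GoodmanWallachGTM255, §4.1.6 with Thm. 3.3.11] -/
theorem exists_adjoin_lieOp_isotypicProjector_glLift {ℓ : ℕ} (h : ℓ ≤ k) (δ : ℕ)
    (χ : Weight (Fin ℓ)) :
    ∃ Z ∈ Algebra.adjoin ℂ (Set.range fun N : Matrix (Fin k) (Fin k) ℂ =>
        (lieOp k d N : Module.End ℂ (MvPolynomial (DegIdx (Fin k) d) ℂ))),
      ∀ Δ : MvPolynomial (DegIdx (Fin k) d) ℂ, Δ.IsHomogeneous δ →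
        Z Δ ∈ hwSubrep ((coordRep (Fin k) ℂ d).comp (glLift h)) χ ∧
          Δ - Z Δ ∈ ⨆ χ' ∈ {χ' : Weight (Fin ℓ) | χ' ≠ χ},
            hwSubrep ((coordRep (Fin k) ℂ d).comp (glLift h)) χ' := by
  classical
  -- the subrepresentation of degree-`δ` metapolynomials, restricted to `GL_ℓ`
  let U : Subrepresentation ((coordRep (Fin k) ℂ d).comp (glLift h)) :=
    { toSubmodule := homogeneousSubmodule (DegIdx (Fin k) d) ℂ δ
      apply_mem_toSubmodule := fun g v hv =>
        (mem_homogeneousSubmodule δ _).2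
          (isHomogeneous_coordSubst (glLift h g) ((mem_homogeneousSubmodule δ _).1 hv)) }
  haveI : FiniteDimensional ℂ U.toSubmodule :=
    Module.Finite.iff_fg.mpr (homogeneousSubmodule_fg (DegIdx (Fin k) d) ℂ δ)
  have hρU : IsRationalRep U.toRepresentation :=
    (isRationalRep_comp_glLift (isRationalRep_coordRep d) h).toRepresentation U
  obtain ⟨r, hr⟩ := exists_monoidAlgebra_isotypicProjector hρU χ
  -- each `ρ(diag(g, 1))` on degree `δ` as an element of the `lieOp`-algebra
  have hP : ∀ g : GL (Fin ℓ) ℂ, ∃ P ∈ Algebra.adjoin ℂ (Set.range fun N : Matrix (Fin k) (Fin k) ℂ =>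
      (lieOp k d N : Module.End ℂ (MvPolynomial (DegIdx (Fin k) d) ℂ))),
      ∀ Δ : MvPolynomial (DegIdx (Fin k) d) ℂ, Δ.IsHomogeneous δ →
        P Δ = coordRep (Fin k) ℂ d (glLift h g) Δ :=
    fun g => exists_adjoin_lieOp_eq_coordRep (glLift h g) δ
  choose P hP𝔄 hP using hP
  refine ⟨r.coeff.sum fun g c => c • P g,
    Subalgebra.sum_mem _ fun g _ => Subalgebra.smul_mem _ (hP𝔄 g) _, fun Δ hΔ => ?_⟩
  set w : U.toSubmodule := ⟨Δ, (mem_homogeneousSubmodule δ _).2 hΔ⟩ with hw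
  -- `Z Δ` is the image of `r • w`
  have hZ : (r.coeff.sum fun g c => c • P g) Δ =
      ((U.toRepresentation.asAlgebraHom r w : U.toSubmodule) :
        MvPolynomial (DegIdx (Fin k) d) ℂ) := by
    rw [Representation.asAlgebraHom_def, MonoidAlgebra.lift_apply, Finsupp.sum, Finsupp.sum,
      LinearMap.sum_apply, LinearMap.sum_apply, Submodule.coe_sum]
    refine Finset.sum_congr rfl fun g _ => ?_
    rw [LinearMap.smul_apply, LinearMap.smul_apply, Submodule.coe_smul, hP g Δ hΔ]
    rfl
  obtain ⟨h1, h2⟩ := hr w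
  constructor
  · rw [hZ]
    exact map_subtype_hwSubrep_toRepresentation_le U χ ⟨_, h1, rfl⟩
  · have hsub : Δ - (r.coeff.sum fun g c => c • P g) Δ =
        ((w - U.toRepresentation.asAlgebraHom r w : U.toSubmodule) :
          MvPolynomial (DegIdx (Fin k) d) ℂ) := by
      rw [Submodule.coe_sub, hZ]
    rw [hsub]
    have hle : (⨆ χ' ∈ {χ' : Weight (Fin ℓ) | χ' ≠ χ}, hwSubrep U.toRepresentation χ').map
        U.toSubmodule.subtype ≤
        ⨆ χ' ∈ {χ' : Weight (Fin ℓ) | χ' ≠ χ},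
          hwSubrep ((coordRep (Fin k) ℂ d).comp (glLift h)) χ' := by
      rw [Submodule.map_iSup]
      refine iSup_mono fun χ' => ?_
      rw [Submodule.map_iSup]
      exact iSup_mono fun _ => map_subtype_hwSubrep_toRepresentation_le U χ'
    exact hle ⟨_, h2, rfl⟩

/-- **A product of level projectors on a Gelfand–Tsetlin component.** If `Z j` acts on degree-`δ`
metapolynomials as the projector onto the `T j`-isotypic component of the level-`j` restriction
(all levels `j ≤ k`), then an ordered product `Z_{j₁} ⋯ Z_{j_r}` acts on a homogeneous vector of
the `T'`-isotypic space `V_{T'}` as the identity when `T'` agrees with `T` at all the levels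
`j₁, …, j_r`, and as `0` otherwise ("under the action of the Gelfand–Tsetlin algebra `GZ(g)` the
representation decomposes into `GZ`-isotypic components indexed by Gelfand–Tsetlin patterns").
[cite: BergEtAl2024, §5.1.4, p.28 (PDF p.29)] locator: paper:arxiv-2411.03444 p0029.txt:L4–L11 -/
theorem list_prod_apply_eq_ite {δ : ℕ} {T T' : GTPattern k}
    {Z : Fin (k + 1) → Module.End ℂ (MvPolynomial (DegIdx (Fin k) d) ℂ)}
    (hZ : ∀ (j : Fin (k + 1)) (Δ : MvPolynomial (DegIdx (Fin k) d) ℂ), Δ.IsHomogeneous δ →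
      Z j Δ ∈ hwSubrep ((coordRep (Fin k) ℂ d).comp (glLift (level_le j))) (T j) ∧
        Δ - Z j Δ ∈ ⨆ χ' ∈ {χ' : Weight (Fin j) | χ' ≠ T j},
          hwSubrep ((coordRep (Fin k) ℂ d).comp (glLift (level_le j))) χ')
    {v : MvPolynomial (DegIdx (Fin k) d) ℂ} (hv : v.IsHomogeneous δ)
    (hvT' : v ∈ gtSubspace (coordRep (Fin k) ℂ d) T') (l : List (Fin (k + 1))) :
    (l.map Z).prod v = if ∀ j ∈ l, T' j = T j then v else 0 := by
  induction l with
  | nil =>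
    rw [List.map_nil, List.prod_nil, Module.End.one_apply, if_pos (by simp)]
  | cons j l ih =>
    rw [List.map_cons, List.prod_cons, Module.End.mul_apply, ih]
    have hvj : v ∈ hwSubrep ((coordRep (Fin k) ℂ d).comp (glLift (level_le j))) (T' j) :=
      (mem_gtSubspace_iff _ _ _).1 hvT' j
    by_cases hl : ∀ i ∈ l, T' i = T i
    · rw [if_pos hl]
      obtain ⟨h1, h2⟩ := hZ j v hv
      by_cases hj : T' j = T j
      · rw [if_pos (fun i hi => by
          rcases List.mem_cons.1 hi with rfl | hi'
          · exact hj
          · exact hl i hi')]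
        rw [hj] at hvj
        exact apply_eq_self_of_mem_hwSubrep (iSupIndep_hwSubrep_coordRep_comp_glLift _) h1 h2 hvj
      · rw [if_neg (fun H => hj (H j (List.mem_cons.2 (Or.inl rfl))))]
        exact apply_eq_zero_of_mem_hwSubrep_of_ne (iSupIndep_hwSubrep_coordRep_comp_glLift _) hj
          h1 h2 hvj
    · rw [if_neg hl, map_zero, if_neg (fun H => hl (fun i hi => H i (List.mem_cons.2 (Or.inr hi))))]

/-- **[BDGIL24, Cor. 5.8] — existence clause (GZ-isotypic projectors).** For every format
`(δ, d, k)` and every chain of integral weights `T` (Gelfand–Tsetlin pattern; non-occurring chains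
have component `0`) there is an element `Y` of the image of `U(gl_k)` (the subalgebra of `End`
generated by the `lieOp N`) which acts on the homogeneous metapolynomials of degree `δ` as THE
projector onto the `T`-isotypic space `V_T = gtSubspace (coordRep) T`: `Y Δ ∈ V_T` and
`Δ − Y Δ ∈ ⨆_{T'≠T} V_{T'}` (the characterisation by which the tree renders "the projection onto the
`T`-isotypic space", `thm_1_1_gt`; unique by `gtComponent_unique`). Here `Y = Z_0 Z_1 ⋯ Z_k` is the
ordered product over the levels of the chain of the level-`j` isotypic projectors for `T j`
(`exists_adjoin_lieOp_isotypicProjector_glLift`) — the `GZ`-isotypic space being the joint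
isotypic space of the restrictions along `gl_1 ⊂ ⋯ ⊂ gl_k` (`gtSubspace`). The printed length bound
`k(δd)^{k²}` (Casimir elements of the `gl_ℓ` and Thm. 5.2) is NOT typed.
[cite: BergEtAl2024, Cor. 5.8, p.28 (PDF p.29)] locator: paper:arxiv-2411.03444 p0029.txt:L23–L26 -/
theorem cor_5_8_exists (k d δ : ℕ) (T : GTPattern k) :
    ∃ Y ∈ Algebra.adjoin ℂ (Set.range fun N : Matrix (Fin k) (Fin k) ℂ =>
        (lieOp k d N : Module.End ℂ (MvPolynomial (DegIdx (Fin k) d) ℂ))),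
      ∀ Δ : MvPolynomial (DegIdx (Fin k) d) ℂ, Δ.IsHomogeneous δ →
        Y Δ ∈ gtSubspace (coordRep (Fin k) ℂ d) T ∧
          Δ - Y Δ ∈ ⨆ T' ∈ {T' : GTPattern k | T' ≠ T}, gtSubspace (coordRep (Fin k) ℂ d) T' := by
  classical
  have hZ : ∀ j : Fin (k + 1), ∃ Z ∈ Algebra.adjoin ℂ (Set.range fun N : Matrix (Fin k) (Fin k) ℂ =>
      (lieOp k d N : Module.End ℂ (MvPolynomial (DegIdx (Fin k) d) ℂ))),
      ∀ Δ : MvPolynomial (DegIdx (Fin k) d) ℂ, Δ.IsHomogeneous δ →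
        Z Δ ∈ hwSubrep ((coordRep (Fin k) ℂ d).comp (glLift (level_le j))) (T j) ∧
          Δ - Z Δ ∈ ⨆ χ' ∈ {χ' : Weight (Fin j) | χ' ≠ T j},
            hwSubrep ((coordRep (Fin k) ℂ d).comp (glLift (level_le j))) χ' :=
    fun j => exists_adjoin_lieOp_isotypicProjector_glLift (level_le j) δ (T j)
  choose Z hZ𝔄 hZ using hZ
  refine ⟨((List.finRange (k + 1)).map Z).prod,
    Subalgebra.list_prod_mem _ (fun x hx => ?_), fun Δ hΔ => ?_⟩
  · obtain ⟨j, -, rfl⟩ := List.mem_map.1 hx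
    exact hZ𝔄 j
  -- decompose `Δ` inside the degree-`δ` part along the Gelfand–Tsetlin components
  set W : Submodule ℂ (MvPolynomial (DegIdx (Fin k) d) ℂ) :=
    homogeneousSubmodule (DegIdx (Fin k) d) ℂ δ with hW
  haveI : FiniteDimensional ℂ W :=
    Module.Finite.iff_fg.mpr (homogeneousSubmodule_fg (DegIdx (Fin k) d) ℂ δ)
  have hWstab : ∀ g, W ≤ W.comap (coordRep (Fin k) ℂ d g) := fun g x hx =>
    (mem_homogeneousSubmodule δ _).2 (isHomogeneous_coordSubst g ((mem_homogeneousSubmodule δ _).1 hx))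
  have hΔmem : Δ ∈ ⨆ T', W ⊓ gtSubspace (coordRep (Fin k) ℂ d) T' :=
    le_iSup_inf_gtSubspace (isRationalRep_coordRep d) W hWstab ((mem_homogeneousSubmodule δ Δ).2 hΔ)
  refine Submodule.iSup_induction (fun T' => W ⊓ gtSubspace (coordRep (Fin k) ℂ d) T')
    (motive := fun x => ((List.finRange (k + 1)).map Z).prod x ∈ gtSubspace (coordRep (Fin k) ℂ d) T ∧
      x - ((List.finRange (k + 1)).map Z).prod x ∈
        ⨆ T' ∈ {T' : GTPattern k | T' ≠ T}, gtSubspace (coordRep (Fin k) ℂ d) T') hΔmem ?_ ?_ ?_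
  · rintro T' x ⟨hxW, hxT'⟩
    have hx : x.IsHomogeneous δ := (mem_homogeneousSubmodule δ x).1 hxW
    rw [list_prod_apply_eq_ite hZ hx hxT']
    by_cases hT : T' = T
    · subst hT
      rw [if_pos (fun j _ => rfl), sub_self]
      exact ⟨hxT', Submodule.zero_mem _⟩
    · obtain ⟨j, hj⟩ := Function.ne_iff.1 hT
      rw [if_neg (fun H => hj (H j (List.mem_finRange j))), sub_zero]
      exact ⟨Submodule.zero_mem _,
        Submodule.mem_iSup_of_mem T' (Submodule.mem_iSup_of_mem hT hxT')⟩
  · rw [map_zero, sub_zero]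
    exact ⟨Submodule.zero_mem _, Submodule.zero_mem _⟩
  · rintro x y ⟨hx, hx'⟩ ⟨hy, hy'⟩
    rw [map_add, add_sub_add_comm]
    exact ⟨Submodule.add_mem _ hx hy, Submodule.add_mem _ hx' hy'⟩

/-- **[BDGIL24, Cor. 5.8] — existence clause, `Y_T ∈ U(gl_k)` as printed**: for every format
`(δ, d, k)` and chain `T` there is `Y ∈ U(gl_k)` acting on the homogeneous metapolynomials of degree
`δ` as THE projector onto the `T`-isotypic space (`cor_5_8_exists` + `range_envAct`). The printed
length bound `k(δd)^{k²}` is NOT typed.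
[cite: BergEtAl2024, Cor. 5.8, p.28 (PDF p.29)] locator: paper:arxiv-2411.03444 p0029.txt:L23–L26 -/
theorem cor_5_8_exists_envAct (k d δ : ℕ) (T : GTPattern k) :
    -- `Y : UniversalEnvelopingAlgebra ℂ (Matrix (Fin k) (Fin k) ℂ)` (type fixed by `envAct`)
    ∃ Y, ∀ Δ : MvPolynomial (DegIdx (Fin k) d) ℂ, Δ.IsHomogeneous δ →
        envAct k d Y Δ ∈ gtSubspace (coordRep (Fin k) ℂ d) T ∧
          Δ - envAct k d Y Δ ∈
            ⨆ T' ∈ {T' : GTPattern k | T' ≠ T}, gtSubspace (coordRep (Fin k) ℂ d) T' := by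
  obtain ⟨Y, hY, h⟩ := cor_5_8_exists k d δ T
  obtain ⟨u, rfl⟩ := mem_adjoin_lieOp_iff_exists_envAct.1 hY
  exact ⟨u, h⟩

end GZ

end BergEtAl2024

end Literature.Barriers.ValiantsHypothesis
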